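import Mathlib
import Summits.Ventures.PercRepro2.K5TheoremI
import Summits.Ventures.PercRepro2.K5Typed
import Summits.Ventures.PercRepro2.CaseOneCubicI

/-!
# THE TYPED (i) ON `K₅` IS A KERNEL THEOREM: `CaseOne.TypedI ends5 0 1 2 3 4`
(blind cell PercRepro2, typer-1 g9; the `(i)`-side twin of `K5Typed.lean`)

The `(i)`-side state kernel `KI` of `CaseOneCubicI.lean` is, on `K₅` with the marks `(0, 1, 2, 3, 4)`,
the signed product of the tables `tQBL, tABL, tABOL` (`b ∈ C₁`) and `tQ, tA, tAO, tPD, tPDoU` of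
`K5Kernel.lean` (`KI_apply`); its typed counts are `cntNeg₁ k − cntPos₁ k` at the profile of the minor
(`typedCountI_eq`), nonnegative by the kernel certificate `K5.cert_i` (`K5Digits.cntPos₁_le_cntNeg₁`).

* **`typedCount_KI_nonneg`**: every weight-free typed count of `KI` on `K₅` is `≥ 0` (all minors, all
  type maps);
* **`typedI_K5`**: `CaseOne.TypedI ends5 0 1 2 3 4` — the typed `(i)` on `K₅`; with `typedII_K5`,
  **`jOneOne_K5'`** re-derives `(J1₁)` on `K₅` through p1's `jOneOne_of_pinned`.
-/

namespace Summit.Ventures.PercRepro2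

open Hub

namespace K5

section Indicators

variable {R : Type*} [Field R]

/-- `1_QB₁` is the table `tQBL`. -/
lemma iQB₁_eq : (CaseOne.iQB₁ ends5 1 2 4 : Config (Fin 10) → R) = indR tQBL := by
  unfold CaseOne.iQB₁
  rw [CovForm.compl_connEvent_eq_Q, Set.inter_comm]
  exact indicator_eq_indR _ tQBL tQBL_iff

/-- `1_AB₁` is the table `tABL`. -/
lemma iAB₁_eq : (CaseOne.iAB₁ ends5 1 2 3 4 : Config (Fin 10) → R) = indR tABL := by
  unfold CaseOne.iAB₁
  rw [CovForm.compl_connEvent_eq_Q]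
  have : connEvent ends5 1 4 ∩ connEvent ends5 1 3 ∩ avoidAll ends5 2 {1} =
      avoidAll ends5 2 {1} ∩ connEvent ends5 1 3 ∩ connEvent ends5 1 4 := by
    ext ω; simp only [Set.mem_inter_iff]; tauto
  rw [this]
  exact indicator_eq_indR _ tABL tABL_iff

/-- `1_AB₁O` is the table `tABOL`. -/
lemma iAB₁O_eq : (CaseOne.iAB₁O ends5 0 1 2 3 4 : Config (Fin 10) → R) = indR tABOL := by
  unfold CaseOne.iAB₁O
  rw [CovForm.compl_connEvent_eq_Q]
  have : connEvent ends5 1 4 ∩ connEvent ends5 1 3 ∩ connEvent ends5 2 0 ∩ avoidAll ends5 2 {1} =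
      avoidAll ends5 2 {1} ∩ connEvent ends5 1 3 ∩ connEvent ends5 1 4 ∩ connEvent ends5 2 0 := by
    ext ω; simp only [Set.mem_inter_iff]; tauto
  rw [this]
  exact indicator_eq_indR _ tABOL tABOL_iff

/-- **The `(i)`-side state kernel on `K₅` is the signed product of the tables.** -/
lemma KI_apply (x y w : Config (Fin 10)) :
    CaseOne.KI (R := R) ends5 0 1 2 3 4 x y w =
      indR tQBL x * indR tAO y * indR tPD w + indR tABL x * indR tPDoU y * indR tQ w -
        indR tABOL x * indR tQ y * indR tPD w - indR tQBL x * indR tPDoU y * indR tA w := by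
  unfold CaseOne.KI CovForm.sepKernel
  simp only [Fin.sum_univ_succ, Fin.sum_univ_zero, Matrix.cons_val_zero, Matrix.cons_val_succ,
    add_zero]
  rw [iQB₁_eq, iAB₁_eq, iAB₁O_eq, iAO_eq, iPDoU_eq, iQ_eq, iPDc_eq, iA_eq]
  ring

end Indicators

section TypedCount

variable {R : Type*} [Field R] [LinearOrder R] [IsStrictOrderedRing R]

omit [LinearOrder R] [IsStrictOrderedRing R] in
/-- **A typed count of `KI` on `K₅` is the signed triple count of its profile.** -/
lemma typedCountI_eq (F : Finset (Fin 10)) (z : Config (Fin 10)) (τ : Fin 10 → ℕ)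
    (k : Fin 10 → Fin 4) (hk : ∀ e, (k e : ℕ) = if e ∈ F then τ e else if z e then 3 else 0) :
    typedCount F z τ (CaseOne.KI (R := R) ends5 0 1 2 3 4) =
      ((cntNeg₁ k : ℕ) : R) - ((cntPos₁ k : ℕ) : R) := by
  rw [show ((cntNeg₁ k : ℕ) : R) - ((cntPos₁ k : ℕ) : R) =
      coef3 (indR tQBL) (indR tAO) (indR tPD) k + coef3 (indR tABL) (indR tPDoU) (indR tQ) k -
        coef3 (indR tABOL) (indR tQ) (indR tPD) k - coef3 (indR tQBL) (indR tPDoU) (indR tA) k by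
    rw [coef3_eq_cnt3, coef3_eq_cnt3, coef3_eq_cnt3, coef3_eq_cnt3]
    unfold cntPos₁ cntNeg₁
    push_cast
    ring]
  unfold typedCount coef3
  simp only [typed_constraint_iff F z τ k hk, KI_apply, Finset.sum_filter, Fintype.sum_prod_type]
  rw [← Finset.sum_add_distrib, ← Finset.sum_sub_distrib, ← Finset.sum_sub_distrib]
  refine Finset.sum_congr rfl fun x _ => ?_
  rw [← Finset.sum_add_distrib, ← Finset.sum_sub_distrib, ← Finset.sum_sub_distrib]
  refine Finset.sum_congr rfl fun y _ => ?_
  rw [← Finset.sum_add_distrib, ← Finset.sum_sub_distrib, ← Finset.sum_sub_distrib]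
  refine Finset.sum_congr rfl fun w _ => ?_
  by_cases h : prof x y w = k <;> simp [h]

/-- **Every weight-free typed count of the `(i)`-side state kernel on `K₅` is nonnegative** — all
minors `(F, z)`, all type maps (the kernel certificate `K5.cert_i`). -/
theorem typedCount_KI_nonneg (F : Finset (Fin 10)) (z : Config (Fin 10)) (τ : Fin 10 → ℕ) :
    0 ≤ typedCount F z τ (CaseOne.KI (R := R) ends5 0 1 2 3 4) := by
  by_cases hτ : ∀ e ∈ F, τ e ≤ 3
  · obtain ⟨k, hk⟩ := exists_profile F z τ hτ
    rw [typedCountI_eq F z τ k hk, sub_nonneg]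
    exact_mod_cast cntPos₁_le_cntNeg₁ k
  · have : typedCount F z τ (CaseOne.KI (R := R) ends5 0 1 2 3 4) = 0 := by
      unfold typedCount
      refine Finset.sum_eq_zero fun x _ => Finset.sum_eq_zero fun y _ =>
        Finset.sum_eq_zero fun w _ => ?_
      rw [if_neg]
      rintro ⟨-, h2⟩
      apply hτ
      intro e he
      rw [← h2 e he]
      unfold openCount
      have := Bool.toNat_le (x e)
      have := Bool.toNat_le (y e)
      have := Bool.toNat_le (w e)
      omega
    rw [this]

/-- **THE TYPED `(i)` ON `K₅`**: `CaseOne.TypedI ends5 0 1 2 3 4`. -/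
theorem typedI_K5 : CaseOne.TypedI (R := R) ends5 0 1 2 3 4 := by
  intro q G σ hq hpin _hσ
  rw [triSum_pinned_eq q G hpin σ]
  exact mul_nonneg (prod_typed_factors_nonneg q hq G σ) (typedCount_KI_nonneg G (pinnedConfig q) σ)

/-- `(i)` on `K₅` a second time, through the typed base and p1's pinning reduction. -/
theorem zSplitI_K5' (p : Fin 10 → R) (hp : IsProbVec p) : CaseOne.ZSplitI p ends5 0 1 2 3 4 :=
  CaseOne.zSplitI_of_pinned ends5 0 1 2 3 4 typedI_K5 p hp

/-- `(J1₁)` on `K₅` a second time, from the two typed bases (`jOneOne_of_pinned`). -/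
theorem jOneOne_K5' (p : Fin 10 → R) (hp : IsProbVec p) : CaseOne.JOneOne p ends5 0 1 2 3 4 :=
  CaseOne.jOneOne_of_pinned ends5 0 1 2 3 4 typedI_K5 typedII_K5 p hp

end TypedCount

end K5

end Summit.Ventures.PercRepro2
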